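import Summits.NavierStokesRegularity.NavierStokesRegularity.Theorems.EfficiencyFloorRigidExitOrbitClosed
import Summits.NavierStokesRegularity.NavierStokesRegularity.Theorems.EfficiencyFloorRigidExitProfileDecay
import HarnessLib

/-!
# Route `EfficiencyFloor`, support `RigidExit` (stmt-25513) on the `ProductionEfficiencyDecay` ladder (stmt-22866):
# TOPOLOGICAL ORBIT SELECTION BY NAME — clause (a) ⟹ a maximiser interval contains a single-orbit sub-interval

Helper file (`--supports stmt-NavierStokesRegularity-22866`; line `efficiency_floor`), assembling `…RigidExitOrbitClosed`
(orbit membership is closed along the flow; Baire selection) with `…RigidExitProfileDecay` (admissible profiles vanish at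
infinity, `H²(ℝ³) ⊂ C₀`): the side hypotheses of `OrbitClosed.exists_single_orbit_subinterval` (continuity, vanishing at infinity,
positive enstrophy of the representatives) are DISCHARGED from the admissibility recorded in clause (a) itself.

* `exists_single_orbit_subinterval_of_classification` — for `c, ν > 0` and finitely many normalised-maximiser representatives
  `ms i` classifying all normalised maximisers modulo the symmetry group (clause (a) of `MaximiserSetRigidity`, classification half,
  VERBATIM), every maximiser interval `[s,s₁] ⊂ (0,T)` of a maximal classical Leray–Hopf rapidly-decaying-datum solution contains a
  non-degenerate sub-interval all of whose slices lie in the orbit of ONE `ms i`.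
* `exists_single_orbit_subinterval_of_maximiserSetRigidity` — the same from the route decl
  `Theses.EfficiencyFloor.MaximiserSetRigidity` BY NAME, for the sharp constant `c⋆` of the landed sharp budget.

READING (what remains of item (i) ORBIT SELECTION of `RigidExit` after `…ScaleClock`, `…OrbitClosed`, `…ProfileDecay` and this
file): on a single-orbit interval `u σ = λ(σ) R(σ) ms i (λ(σ) R(σ)⁻¹(· − a(σ)))` the scale `λ = Z(u ·)/Z(ms i)` is differentiable
(`ScaleClock`); it remains to select DIFFERENTIABLE rotation and translation paths `R(σ)`, `a(σ)` at one instant (slice theorem for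
the Euclidean group acting on the `H²` profile `ms i`; the stabiliser of a non-zero `L²` field in `E(3)` is compact), after which
`ScaleClock.no_movingOrbit_solution_of_orbitForm` closes item (i). Item (ii) (continuous dependence in `Ḣ¹∩Ḣ²`) is untouched.
HONEST FRAMING: statements about a HYPOTHETICAL blow-up; `RigidExit`, clause (a), `NearMaximiserBoundedAmplification`,
`LerayFloorGap`, `ProductionEfficiencyDecay` (stmt-22866) and Navier–Stokes regularity stay OPEN; no summit statement is proved.
[folklore]
-/

-- the problem directory repeats the summit name (`NavierStokesRegularity/NavierStokesRegularity`)
set_option linter.dupNamespace false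

noncomputable section

open Set Filter MeasureTheory Topology Function
open scoped InnerProductSpace RealInnerProductSpace ENNReal NNReal
open Literature.Analysis.FluidPDE

namespace Summit.NavierStokesRegularity.NavierStokesRegularity.Theorems

namespace RigidExit

namespace OrbitSelection

open NearMaximiserBoundedAmplification MaximiserSetRigidity.ProfileLiouville Resonance ScaleClock OrbitClosed ProfileDecay

/-- **Topological orbit selection from the classification half of clause (a)** (side hypotheses discharged). [folklore] -/
theorem exists_single_orbit_subinterval_of_classification {c ν T : ℝ} (hν : 0 < ν) (hT : 0 < T)
    {u : ℝ → EuclideanSpace ℝ (Fin 3) → EuclideanSpace ℝ (Fin 3)} {p : ℝ → EuclideanSpace ℝ (Fin 3) → ℝ}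
    (hmax : IsMaximalSmoothSolution ν 0 u p T) (hLH : IsLerayHopfOn T ν 0 (u 0) u) (hdec : HasRapidSpatialDecay (u 0))
    {k : ℕ} (ms : Fin k → EuclideanSpace ℝ (Fin 3) → EuclideanSpace ℝ (Fin 3))
    (hms : ∀ i, (ContDiff ℝ (⊤ : ℕ∞) (ms i) ∧ VectorCalculus.IsDivFree (ms i) ∧
        (∫⁻ x, ‖iteratedFDeriv ℝ 0 (ms i) x‖ₑ ^ 2 < ⊤) ∧ (∫⁻ x, ‖iteratedFDeriv ℝ 1 (ms i) x‖ₑ ^ 2 < ⊤) ∧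
        (∫⁻ x, ‖iteratedFDeriv ℝ 2 (ms i) x‖ₑ ^ 2 < ⊤)) ∧ 0 < (∫ x, ‖curl (ms i) x‖ ^ 2))
    (hclass : ∀ m : EuclideanSpace ℝ (Fin 3) → EuclideanSpace ℝ (Fin 3), ((ContDiff ℝ (⊤ : ℕ∞) m ∧ VectorCalculus.IsDivFree m ∧
        (∫⁻ x, ‖iteratedFDeriv ℝ 0 m x‖ₑ ^ 2 < ⊤) ∧ (∫⁻ x, ‖iteratedFDeriv ℝ 1 m x‖ₑ ^ 2 < ⊤) ∧
        (∫⁻ x, ‖iteratedFDeriv ℝ 2 m x‖ₑ ^ 2 < ⊤)) ∧ 0 < (∫ x, ‖curl m x‖ ^ 2) ∧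
        (∫ x, ⟪curl m x, fderiv ℝ m x (curl m x)⟫_ℝ) = c * (∫ x, ‖curl m x‖ ^ 2) ^ (3 / 4 : ℝ) *
          (∫ x, frobeniusNormSq (fderiv ℝ (curl m) x)) ^ (3 / 4 : ℝ) ∧
        (∫ x, frobeniusNormSq (fderiv ℝ (curl m) x)) = 81 * c ^ 4 / (256 * ν ^ 4) * (∫ x, ‖curl m x‖ ^ 2) ^ 3) →
      ∃ (i : Fin k) (a : EuclideanSpace ℝ (Fin 3)) (R : EuclideanSpace ℝ (Fin 3) ≃ₗᵢ[ℝ] EuclideanSpace ℝ (Fin 3)) (l : ℝ),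
        0 < l ∧ m = fun x => l • R (ms i (l • R.symm (x - a))))
    {s s₁ : ℝ} (hs0 : 0 < s) (hss₁ : s < s₁) (hs₁T : s₁ < T)
    (hNM : ∀ σ ∈ Icc s s₁, ((ContDiff ℝ (⊤ : ℕ∞) (u σ) ∧ VectorCalculus.IsDivFree (u σ) ∧
        (∫⁻ x, ‖iteratedFDeriv ℝ 0 (u σ) x‖ₑ ^ 2 < ⊤) ∧ (∫⁻ x, ‖iteratedFDeriv ℝ 1 (u σ) x‖ₑ ^ 2 < ⊤) ∧
        (∫⁻ x, ‖iteratedFDeriv ℝ 2 (u σ) x‖ₑ ^ 2 < ⊤)) ∧ 0 < (∫ x, ‖curl (u σ) x‖ ^ 2) ∧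
        (∫ x, ⟪curl (u σ) x, fderiv ℝ (u σ) x (curl (u σ) x)⟫_ℝ) = c * (∫ x, ‖curl (u σ) x‖ ^ 2) ^ (3 / 4 : ℝ) *
          (∫ x, frobeniusNormSq (fderiv ℝ (curl (u σ)) x)) ^ (3 / 4 : ℝ) ∧
        (∫ x, frobeniusNormSq (fderiv ℝ (curl (u σ)) x)) = 81 * c ^ 4 / (256 * ν ^ 4) * (∫ x, ‖curl (u σ) x‖ ^ 2) ^ 3)) :
    ∃ (i : Fin k) (s' s₁' : ℝ), s ≤ s' ∧ s' < s₁' ∧ s₁' ≤ s₁ ∧ ∀ σ ∈ Icc s' s₁',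
      ∃ (a : EuclideanSpace ℝ (Fin 3)) (R : EuclideanSpace ℝ (Fin 3) ≃ₗᵢ[ℝ] EuclideanSpace ℝ (Fin 3)) (l : ℝ),
        0 < l ∧ u σ = fun x => l • R (ms i (l • R.symm (x - a))) :=
  OrbitClosed.exists_single_orbit_subinterval hν hT hmax hLH hdec ms
    (fun i => (hms i).1.1.continuous) (fun i => tendsto_cocompact_of_admissible (hms i).1) (fun i => (hms i).2)
    hclass hs0 hss₁ hs₁T hNM

/-- **Topological orbit selection from the route decl `MaximiserSetRigidity`, BY NAME** (sharp constant `c⋆` of the landed sharp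
budget; clause (a) supplies the representatives at each viscosity). [folklore] -/
theorem exists_single_orbit_subinterval_of_maximiserSetRigidity
    (hM : Summit.NavierStokesRegularity.NavierStokesRegularity.Theses.EfficiencyFloor.MaximiserSetRigidity) :
    ∃ c : ℝ, (0 < c ∧ (∀ v : EuclideanSpace ℝ (Fin 3) → EuclideanSpace ℝ (Fin 3), (ContDiff ℝ (⊤ : ℕ∞) v ∧
      VectorCalculus.IsDivFree v ∧ (∫⁻ x, ‖iteratedFDeriv ℝ 0 v x‖ₑ ^ 2 < ⊤) ∧ (∫⁻ x, ‖iteratedFDeriv ℝ 1 v x‖ₑ ^ 2 < ⊤) ∧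
      (∫⁻ x, ‖iteratedFDeriv ℝ 2 v x‖ₑ ^ 2 < ⊤)) → (∫ x, ⟪curl v x, fderiv ℝ v x (curl v x)⟫_ℝ) ≤
      c * (∫ x, ‖curl v x‖ ^ 2) ^ (3 / 4 : ℝ) * (∫ x, frobeniusNormSq (fderiv ℝ (curl v) x)) ^ (3 / 4 : ℝ)) ∧
      ∀ c' : ℝ, (∀ w : EuclideanSpace ℝ (Fin 3) → EuclideanSpace ℝ (Fin 3), (ContDiff ℝ (⊤ : ℕ∞) w ∧
      VectorCalculus.IsDivFree w ∧ (∫⁻ x, ‖iteratedFDeriv ℝ 0 w x‖ₑ ^ 2 < ⊤) ∧ (∫⁻ x, ‖iteratedFDeriv ℝ 1 w x‖ₑ ^ 2 < ⊤) ∧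
      (∫⁻ x, ‖iteratedFDeriv ℝ 2 w x‖ₑ ^ 2 < ⊤)) → (∫ x, ⟪curl w x, fderiv ℝ w x (curl w x)⟫_ℝ) ≤
      c' * (∫ x, ‖curl w x‖ ^ 2) ^ (3 / 4 : ℝ) * (∫ x, frobeniusNormSq (fderiv ℝ (curl w) x)) ^ (3 / 4 : ℝ)) → c ≤ c') ∧
      ∀ (ν T : ℝ), 0 < ν → 0 < T →
      ∀ (u : ℝ → EuclideanSpace ℝ (Fin 3) → EuclideanSpace ℝ (Fin 3)) (p : ℝ → EuclideanSpace ℝ (Fin 3) → ℝ),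
      IsMaximalSmoothSolution ν 0 u p T → IsLerayHopfOn T ν 0 (u 0) u → HasRapidSpatialDecay (u 0) →
      ∃ (k : ℕ) (ms : Fin k → EuclideanSpace ℝ (Fin 3) → EuclideanSpace ℝ (Fin 3)),
        (∀ i, ((ContDiff ℝ (⊤ : ℕ∞) (ms i) ∧ VectorCalculus.IsDivFree (ms i) ∧
          (∫⁻ x, ‖iteratedFDeriv ℝ 0 (ms i) x‖ₑ ^ 2 < ⊤) ∧ (∫⁻ x, ‖iteratedFDeriv ℝ 1 (ms i) x‖ₑ ^ 2 < ⊤) ∧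
          (∫⁻ x, ‖iteratedFDeriv ℝ 2 (ms i) x‖ₑ ^ 2 < ⊤)) ∧ 0 < (∫ x, ‖curl (ms i) x‖ ^ 2) ∧
          (∫ x, ⟪curl (ms i) x, fderiv ℝ (ms i) x (curl (ms i) x)⟫_ℝ) = c * (∫ x, ‖curl (ms i) x‖ ^ 2) ^ (3 / 4 : ℝ) *
            (∫ x, frobeniusNormSq (fderiv ℝ (curl (ms i)) x)) ^ (3 / 4 : ℝ) ∧
          (∫ x, frobeniusNormSq (fderiv ℝ (curl (ms i)) x)) = 81 * c ^ 4 / (256 * ν ^ 4) * (∫ x, ‖curl (ms i) x‖ ^ 2) ^ 3)) ∧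
        ∀ s s₁ : ℝ, 0 < s → s < s₁ → s₁ < T → (∀ σ ∈ Icc s s₁, ((ContDiff ℝ (⊤ : ℕ∞) (u σ) ∧ VectorCalculus.IsDivFree (u σ) ∧
          (∫⁻ x, ‖iteratedFDeriv ℝ 0 (u σ) x‖ₑ ^ 2 < ⊤) ∧ (∫⁻ x, ‖iteratedFDeriv ℝ 1 (u σ) x‖ₑ ^ 2 < ⊤) ∧
          (∫⁻ x, ‖iteratedFDeriv ℝ 2 (u σ) x‖ₑ ^ 2 < ⊤)) ∧ 0 < (∫ x, ‖curl (u σ) x‖ ^ 2) ∧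
          (∫ x, ⟪curl (u σ) x, fderiv ℝ (u σ) x (curl (u σ) x)⟫_ℝ) = c * (∫ x, ‖curl (u σ) x‖ ^ 2) ^ (3 / 4 : ℝ) *
            (∫ x, frobeniusNormSq (fderiv ℝ (curl (u σ)) x)) ^ (3 / 4 : ℝ) ∧
          (∫ x, frobeniusNormSq (fderiv ℝ (curl (u σ)) x)) = 81 * c ^ 4 / (256 * ν ^ 4) * (∫ x, ‖curl (u σ) x‖ ^ 2) ^ 3)) →
        ∃ (i : Fin k) (s' s₁' : ℝ), s ≤ s' ∧ s' < s₁' ∧ s₁' ≤ s₁ ∧ ∀ σ ∈ Icc s' s₁',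
          ∃ (a : EuclideanSpace ℝ (Fin 3)) (R : EuclideanSpace ℝ (Fin 3) ≃ₗᵢ[ℝ] EuclideanSpace ℝ (Fin 3)) (l : ℝ),
            0 < l ∧ u σ = fun x => l • R (ms i (l • R.symm (x - a))) := by
  obtain ⟨c, hsharp, -⟩ := exists_budget_saturated_iff_normalisedMaximiser
  refine ⟨c, hsharp, fun ν T hν hT u p hmax hLH hdec => ?_⟩
  obtain ⟨k, ms, hms, hclass⟩ := partA_of_maximiserSetRigidity hM c ν hsharp hν
  refine ⟨k, ms, hms, fun s s₁ hs0 hss₁ hs₁T hNM => ?_⟩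
  exact exists_single_orbit_subinterval_of_classification hν hT hmax hLH hdec ms (fun i => ⟨(hms i).1, (hms i).2.1⟩)
    hclass hs0 hss₁ hs₁T hNM

end OrbitSelection

end RigidExit

end Summit.NavierStokesRegularity.NavierStokesRegularity.Theorems
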